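import Literature.Combinatorics.HironakaPolyhedraGame.MonomialEResolution

/-!
# Fan stages of the monomial E-resolution problem: the fan/coherence invariant of strictly reachable stages (dimension `n`)

Sources: W. Fulton, *Introduction to toric varieties* (1993) [Fulton1993Toric], §2.6 (star subdivisions of simplicial fans
preserve the fan property; the new ray lies in the relative interior of the subdivided face); [Blanco2012a] Def. 1.16
(the — non-affine — BBOE of a stage is covered by the affine charts of a regular toric variety) and Def. 1.22 / Rem. 1.23
(transformations at combinatorial centres).

## What this file is

The rendering `MonomialEResolution.lean` (`HConeN`, `HStageN`, `StrictReachableN`, F-70 `Blanco2012a_thm_4_6_monomial`) records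
a stage as a LIST of charts, each with its own rays and heights; legality of a face is «permissible at EVERY corner containing
it».  To use it one needs the FAN INVARIANT of the stages actually reachable from the standard corner: in every corner the
rays are linearly independent, two corners meet along the cone of their common rays, and the heights are ONE function of the
ray vector across the stage.  Consequences: the new ray `ρ_R = Σ_{r∈R} r` of a genuine subdivision (`|R| ≥ 2`) is FRESH (not a
ray of any corner), heights stay coherent, boards stay positions, and legality is face-intrinsic.  This is the dimension-`n`
twin, in `Literature/`, of the resolution cell's dimension-3 bricks (res-type-022, `…Corridor3SigmaCornerFan{,Blowup}.lean`,
Summit-side, which a Literature file may not import); statements and proofs follow those files line by line with `3 ↦ n`.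
Elementary linear algebra over `ℚⁿ`; everything proved; no named fact, no instance, no notation.  Consumer: the transport of
`MGame.solvable_of_wf` to `Blanco2012a_thm_4_6_monomial` (`MonomialEResolutionHolds.lean`).
-/

namespace Literature.Combinatorics.HironakaPolyhedraGame

open Finset
open scoped BigOperators
open Classical

variable {n : ℕ}

/-! ## §1 Rational rays, combinations, the invariant -/

section FanDefs

/-- The `k`-th ray of a corner as a rational vector. [cite: Fulton1993Toric, §2.6] -/
def HConeN.rq (c : HConeN n) (k : Fin n) : Fin n → ℚ := fun i => (c.ray k i : ℚ)

/-- The rational combination `Σ_k λ_k r_k` of the rays of `c`. [cite: Fulton1993Toric, §2.6] -/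
def HConeN.comb (c : HConeN n) (lam : Fin n → ℚ) : Fin n → ℚ := ∑ k, lam k • c.rq k

/-- `x` lies in the closed cone of `c`: a non-negative combination of its rays. [cite: Fulton1993Toric, §2.6] -/
def HConeN.InCone (c : HConeN n) (x : Fin n → ℚ) : Prop := ∃ lam : Fin n → ℚ, (∀ k, 0 ≤ lam k) ∧ c.comb lam = x

/-- The rays of `c` are linearly independent over `ℚ` (a simplicial cone). [cite: Fulton1993Toric, §2.6] -/
def HConeN.Indep (c : HConeN n) : Prop := LinearIndependent ℚ c.rq

/-- FACE-INTERSECTION property of the ordered pair `(c, c')`: every non-negative representation, in the rays of `c`, of a point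
of the closed cone of `c'` is supported on rays common to `c` and `c'` (the two cones meet in the cone of their common rays —
the fan axiom for simplicial cones).  [cite: Fulton1993Toric, §2.6 with §1.4] -/
def HConeN.FaceInter (c c' : HConeN n) : Prop :=
  ∀ lam : Fin n → ℚ, (∀ k, 0 ≤ lam k) → c'.InCone (c.comb lam) → ∀ k, lam k ≠ 0 → c.ray k ∈ Set.range c'.ray

/-- Heights are a function of the ray VECTOR across the stage. [cite: Blanco2012a, Def. 1.16, Def. 1.22] -/
def HStageN.HeightFn (S : HStageN n) (H : (Fin n → ℤ) → ℤ) : Prop := ∀ c ∈ S, ∀ k, c.height k = H (c.ray k)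

/-- **The fan invariant** of a stage: independent rays in every corner, pairwise face intersections, coherent heights.
[cite: Fulton1993Toric, §2.6; Blanco2012a, Def. 1.16] -/
def HStageN.IsFan (S : HStageN n) : Prop :=
  (∀ c ∈ S, c.Indep) ∧ (∀ c ∈ S, ∀ c' ∈ S, c.FaceInter c') ∧ ∃ H, S.HeightFn H

end FanDefs

/-! ## §2 Coordinates -/

section Coordinates

/-- Coordinates of a combination. [cite: Fulton1993Toric, §2.6] -/
theorem HConeN.comb_apply (c : HConeN n) (lam : Fin n → ℚ) (i : Fin n) :
    c.comb lam i = ∑ k, lam k * (c.ray k i : ℚ) := by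
  simp [HConeN.comb, HConeN.rq, Finset.sum_apply, Pi.smul_apply, smul_eq_mul]

/-- Unique coordinates in an independent corner. [cite: Fulton1993Toric, §2.6] -/
theorem HConeN.Indep.comb_injective {c : HConeN n} (h : c.Indep) : Function.Injective c.comb := by
  intro lam mu hlm
  have := (Fintype.linearIndependent_iff.mp h) (lam - mu) (by
    have h0 : c.comb lam - c.comb mu = 0 := sub_eq_zero.mpr hlm
    simpa [HConeN.comb, sub_smul, Finset.sum_sub_distrib] using h0)
  funext k
  exact sub_eq_zero.mp (this k)

/-- Linear independence from injectivity of `comb` at `0`. [cite: Fulton1993Toric, §2.6] -/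
theorem HConeN.indep_of_comb_eq_zero {c : HConeN n} (h : ∀ mu, c.comb mu = 0 → mu = 0) : c.Indep := by
  rw [HConeN.Indep, Fintype.linearIndependent_iff]
  intro g hg k
  have := h g (by simpa [HConeN.comb] using hg)
  simp [this]

/-- The single ray `r_k` is the combination with coefficients `Pi.single k 1`. [cite: Fulton1993Toric, §2.6] -/
theorem HConeN.comb_single (c : HConeN n) (k : Fin n) : c.comb (Pi.single k 1) = c.rq k := by
  simp [HConeN.comb, Pi.single_apply, Finset.sum_ite_eq']

/-- Independent rays are pairwise distinct. [cite: Fulton1993Toric, §2.6] -/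
theorem HConeN.Indep.ray_injective {c : HConeN n} (h : c.Indep) : Function.Injective c.ray := by
  intro k k' hkk'
  have hq : c.rq k = c.rq k' := by funext i; simp [HConeN.rq, hkk']
  exact h.injective.eq_iff.mp hq

/-- A non-negative combination lies in the cone. [cite: Fulton1993Toric, §2.6] -/
theorem HConeN.inCone_comb (c : HConeN n) {lam : Fin n → ℚ} (h : ∀ k, 0 ≤ lam k) : c.InCone (c.comb lam) :=
  ⟨lam, h, rfl⟩

/-- PULL-BACK of child coordinates to parent coordinates for the child `c.child T s`, `s ∈ T` (`r'_s = Σ_{t∈T} r_t`, other rays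
unchanged).  [cite: Fulton1993Toric, §2.6] -/
def pullN (T : Finset (Fin n)) (s : Fin n) (mu : Fin n → ℚ) : Fin n → ℚ :=
  fun k => (if k = s then 0 else mu k) + (if k ∈ T then mu s else 0)

/-- `pullN` at the new slot `s` is `μ_s`. [cite: Fulton1993Toric, §2.6] -/
theorem pullN_self (T : Finset (Fin n)) {s : Fin n} (hs : s ∈ T) (mu : Fin n → ℚ) : pullN T s mu s = mu s := by
  simp [pullN, hs]

/-- `pullN` at an old slot of the face is `μ_k + μ_s`. [cite: Fulton1993Toric, §2.6] -/
theorem pullN_of_mem (T : Finset (Fin n)) {s k : Fin n} (hk : k ∈ T) (hks : k ≠ s) (mu : Fin n → ℚ) :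
    pullN T s mu k = mu k + mu s := by simp [pullN, hk, hks]

/-- `pullN` off the face is `μ_k`. [cite: Fulton1993Toric, §2.6] -/
theorem pullN_of_not_mem (T : Finset (Fin n)) {s k : Fin n} (hk : k ∉ T) (hs : s ∈ T) (mu : Fin n → ℚ) :
    pullN T s mu k = mu k := by
  have hks : k ≠ s := fun h => hk (h ▸ hs)
  simp [pullN, hk, hks]

/-- `pullN` preserves non-negativity. [cite: Fulton1993Toric, §2.6] -/
theorem pullN_nonneg (T : Finset (Fin n)) {s : Fin n} (hs : s ∈ T) {mu : Fin n → ℚ} (h : ∀ k, 0 ≤ mu k) (k : Fin n) :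
    0 ≤ pullN T s mu k := by
  have _ := hs
  unfold pullN
  refine add_nonneg ?_ ?_ <;> split_ifs <;> first | exact le_rfl | exact h _

/-- On the face slots the pulled coefficient dominates `μ_s`. [cite: Fulton1993Toric, §2.6] -/
theorem le_pullN_of_mem (T : Finset (Fin n)) {s : Fin n} (hs : s ∈ T) {mu : Fin n → ℚ} (h : ∀ k, 0 ≤ mu k) {t : Fin n}
    (ht : t ∈ T) : mu s ≤ pullN T s mu t := by
  by_cases hts : t = s
  · subst hts; rw [pullN_self T hs]
  · rw [pullN_of_mem T ht hts]; linarith [h t]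

/-- Off the new slot the pulled coefficient dominates `μ_k`. [cite: Fulton1993Toric, §2.6] -/
theorem le_pullN_of_ne (T : Finset (Fin n)) {s : Fin n} (hs : s ∈ T) {mu : Fin n → ℚ} (h : ∀ k, 0 ≤ mu k) {k : Fin n}
    (hks : k ≠ s) : mu k ≤ pullN T s mu k := by
  by_cases hk : k ∈ T
  · rw [pullN_of_mem T hk hks]; linarith [h s]
  · rw [pullN_of_not_mem T hk hs]

/-- The child's new ray is `Σ_{t∈T} r_t`. [cite: Blanco2012a, Def. 1.22] -/
theorem HConeN.ray_child_self (c : HConeN n) (T : Finset (Fin n)) (s : Fin n) :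
    (c.child T s).ray s = ∑ t ∈ T, c.ray t := by simp [HConeN.child]

/-- The child's other rays are unchanged. [cite: Blanco2012a, Def. 1.22] -/
theorem HConeN.ray_child_of_ne (c : HConeN n) (T : Finset (Fin n)) {s k : Fin n} (hk : k ≠ s) :
    (c.child T s).ray k = c.ray k := by simp [HConeN.child, hk]

/-- The child's new height is `1 + Σ_{t∈T} b_t` (heights law). [cite: EncinasVillamayor1998, Def. 1.4] -/
theorem HConeN.height_child_self (c : HConeN n) (T : Finset (Fin n)) (s : Fin n) :
    (c.child T s).height s = 1 + ∑ t ∈ T, c.height t := by simp [HConeN.child]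

/-- The child's other heights are unchanged. [cite: EncinasVillamayor1998, Def. 1.4] -/
theorem HConeN.height_child_of_ne (c : HConeN n) (T : Finset (Fin n)) {s k : Fin n} (hk : k ≠ s) :
    (c.child T s).height k = c.height k := by simp [HConeN.child, hk]

/-- **Child coordinates pull back to parent coordinates.** [cite: Fulton1993Toric, §2.6] -/
theorem HConeN.comb_child (c : HConeN n) (T : Finset (Fin n)) {s : Fin n} (hs : s ∈ T) (mu : Fin n → ℚ) :
    (c.child T s).comb mu = c.comb (pullN T s mu) := by
  funext i
  rw [HConeN.comb_apply, HConeN.comb_apply]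
  set r : Fin n → ℚ := fun k => (c.ray k i : ℚ) with hr
  set ST : ℚ := ∑ t ∈ T, r t with hST
  have hray : ∀ k, ((c.child T s).ray k i : ℚ) = if k = s then ST else r k := by
    intro k
    by_cases hk : k = s
    · subst hk; simp [HConeN.child, Finset.sum_apply, hST, hr]
    · simp [HConeN.child, hk, hr]
  have hL : (fun k => mu k * ((c.child T s).ray k i : ℚ)) = Function.update (fun k => mu k * r k) s (mu s * ST) := by
    funext k
    rw [hray]
    by_cases hk : k = s
    · subst hk; simp
    · simp [hk]
  have eL : ∑ k, mu k * ((c.child T s).ray k i : ℚ) = mu s * ST + ∑ k ∈ Finset.univ \ {s}, mu k * r k := by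
    rw [show (∑ k, mu k * ((c.child T s).ray k i : ℚ)) = ∑ k, Function.update (fun k => mu k * r k) s (mu s * ST) k
      from congrArg (fun f : Fin n → ℚ => ∑ k, f k) hL]
    exact Finset.sum_update_of_mem (Finset.mem_univ s) _ _
  have h1 : (fun k => (if k = s then 0 else mu k) * r k) = Function.update (fun k => mu k * r k) s 0 := by
    funext k
    by_cases hk : k = s
    · subst hk; simp
    · simp [hk]
  have eR1 : ∑ k, (if k = s then 0 else mu k) * r k = 0 + ∑ k ∈ Finset.univ \ {s}, mu k * r k := by
    rw [show (∑ k, (if k = s then 0 else mu k) * r k) = ∑ k, Function.update (fun k => mu k * r k) s 0 k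
      from congrArg (fun f : Fin n → ℚ => ∑ k, f k) h1]
    exact Finset.sum_update_of_mem (Finset.mem_univ s) _ _
  have eR2 : ∑ k, (if k ∈ T then mu s else 0) * r k = mu s * ST := by
    simp only [ite_mul, zero_mul, Finset.sum_ite_mem, Finset.univ_inter, hST, Finset.mul_sum]
  have eR : ∑ k, pullN T s mu k * (c.ray k i : ℚ) =
      (∑ k, (if k = s then 0 else mu k) * r k) + ∑ k, (if k ∈ T then mu s else 0) * r k := by
    rw [← Finset.sum_add_distrib]
    refine Finset.sum_congr rfl (fun k _ => ?_)
    rw [pullN, add_mul]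
  rw [eR, eR1, eR2, eL]
  ring

/-- The child of an independent corner (along a slot set containing the reply) is independent. [cite: Fulton1993Toric, §2.6] -/
theorem HConeN.Indep.child {c : HConeN n} (h : c.Indep) (T : Finset (Fin n)) {s : Fin n} (hs : s ∈ T) :
    (c.child T s).Indep := by
  refine HConeN.indep_of_comb_eq_zero (fun mu hmu => ?_)
  rw [HConeN.comb_child c T hs] at hmu
  have h0 : pullN T s mu = 0 := h.comb_injective (by rw [hmu]; simp [HConeN.comb])
  have hs0 : mu s = 0 := by have := congr_fun h0 s; rwa [pullN_self T hs] at this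
  funext k
  show mu k = 0
  by_cases hks : k = s
  · subst hks; exact hs0
  · have hk0 : pullN T s mu k = 0 := by rw [h0]; rfl
    by_cases hk : k ∈ T
    · rw [pullN_of_mem T hk hks] at hk0; linarith
    · rwa [pullN_of_not_mem T hk hs] at hk0

/-- A point of the child's cone is a point of the parent's cone. [cite: Fulton1993Toric, §2.6] -/
theorem HConeN.inCone_of_inCone_child (c : HConeN n) (T : Finset (Fin n)) {s : Fin n} (hs : s ∈ T) {x : Fin n → ℚ}
    (hx : (c.child T s).InCone x) : c.InCone x := by
  obtain ⟨mu, hmu, rfl⟩ := hx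
  exact ⟨pullN T s mu, pullN_nonneg T hs hmu, (HConeN.comb_child c T hs mu).symm⟩

end Coordinates

/-! ## §3 Slots, the new ray, freshness, transport of coefficients -/

section Slots

/-- An integer ray as a rational vector. [cite: Fulton1993Toric, §2.6] -/
def vqN (r : Fin n → ℤ) : Fin n → ℚ := fun i => (r i : ℚ)

/-- `rq = vqN ∘ ray`. [cite: Fulton1993Toric, §2.6] -/
theorem HConeN.rq_eq_vqN (c : HConeN n) (k : Fin n) : c.rq k = vqN (c.ray k) := rfl

/-- The rational form of an integer vector determines it. [cite: Fulton1993Toric, §2.6] -/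
theorem vqN_injective : Function.Injective (vqN (n := n)) := by
  intro r r' h; funext i; have := congr_fun h i; simpa [vqN] using this

/-- A slot lies in `c.slots R` iff its ray lies in `R`. [cite: Blanco2012a, Rem. 1.23] -/
@[simp] theorem HConeN.mem_slots (c : HConeN n) (R : Finset (Fin n → ℤ)) (t : Fin n) :
    t ∈ c.slots R ↔ c.ray t ∈ R := by
  simp [HConeN.slots]

/-- The ray set of the slots of a contained face is the face. [cite: Blanco2012a, Rem. 1.23] -/
theorem HConeN.image_slots {c : HConeN n} {R : Finset (Fin n → ℤ)} (hR : c.Contains R) : (c.slots R).image c.ray = R := by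
  ext r
  simp only [Finset.mem_image, HConeN.mem_slots]
  constructor
  · rintro ⟨t, ht, rfl⟩; exact ht
  · intro hr
    obtain ⟨t, -, rfl⟩ := Finset.mem_image.mp (hR hr)
    exact ⟨t, hr, rfl⟩

/-- Sums over the slots of a contained face are sums over the face (independent corner). [cite: Blanco2012a, Rem. 1.23] -/
theorem HConeN.sum_slots {β : Type*} [AddCommMonoid β] {c : HConeN n} (hc : c.Indep) {R : Finset (Fin n → ℤ)}
    (hR : c.Contains R) (F : (Fin n → ℤ) → β) : ∑ t ∈ c.slots R, F (c.ray t) = ∑ r ∈ R, F r := by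
  calc ∑ t ∈ c.slots R, F (c.ray t) = ∑ r ∈ (c.slots R).image c.ray, F r :=
        (Finset.sum_image (fun x _ y _ h => hc.ray_injective h)).symm
    _ = ∑ r ∈ R, F r := by rw [HConeN.image_slots hR]

/-- An independent corner containing `R` has exactly `|R|` slots in `R`. [cite: Blanco2012a, Rem. 1.23] -/
theorem HConeN.card_slots {c : HConeN n} (hc : c.Indep) {R : Finset (Fin n → ℤ)} (hR : c.Contains R) :
    (c.slots R).card = R.card := by
  conv_rhs => rw [← HConeN.image_slots hR]
  rw [Finset.card_image_of_injective _ hc.ray_injective]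

/-- The vector of the star-subdivision ray of the face `R`: `ρ_R = Σ_{r∈R} r`. [cite: Fulton1993Toric, §2.6] -/
def rhoN (R : Finset (Fin n → ℤ)) : Fin n → ℤ := ∑ r ∈ R, r

/-- In an independent corner containing `R`, the child's new ray IS `ρ_R`. [cite: Fulton1993Toric, §2.6] -/
theorem HConeN.ray_child_slots_self {c : HConeN n} (hc : c.Indep) {R : Finset (Fin n → ℤ)} (hR : c.Contains R) (s : Fin n) :
    (c.child (c.slots R) s).ray s = rhoN R := by
  rw [HConeN.ray_child_self, rhoN]; exact HConeN.sum_slots hc hR id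

/-- The child's new height is `1 + Σ_{r∈R} H r` when heights are `H ∘ ray`. [cite: EncinasVillamayor1998, Def. 1.4] -/
theorem HConeN.height_child_slots_self {c : HConeN n} (hc : c.Indep) {R : Finset (Fin n → ℤ)} (hR : c.Contains R) (s : Fin n)
    {H : (Fin n → ℤ) → ℤ} (hH : ∀ k, c.height k = H (c.ray k)) :
    (c.child (c.slots R) s).height s = 1 + ∑ r ∈ R, H r := by
  rw [HConeN.height_child_self, ← HConeN.sum_slots hc hR H]
  congr 1
  exact Finset.sum_congr rfl (fun t _ => hH t)

/-- `ρ_R` as a rational vector is the indicator combination of the slots. [cite: Fulton1993Toric, §2.6] -/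
theorem HConeN.comb_indicator_slots {c : HConeN n} (hc : c.Indep) {R : Finset (Fin n → ℤ)} (hR : c.Contains R) :
    c.comb (fun k => if k ∈ c.slots R then 1 else 0) = vqN (rhoN R) := by
  have h1 : c.comb (fun k => if k ∈ c.slots R then 1 else 0) = ∑ t ∈ c.slots R, c.rq t := by
    simp only [HConeN.comb, ite_smul, one_smul, zero_smul, Finset.sum_ite_mem, Finset.univ_inter]
  rw [h1]
  have h2 : ∑ t ∈ c.slots R, c.rq t = ∑ r ∈ R, vqN r := HConeN.sum_slots hc hR vqN
  rw [h2, rhoN]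
  funext i
  simp [vqN, Finset.sum_apply]

/-- **TRANSPORT OF COEFFICIENTS.** A combination over `c'` supported on rays of `c` is a combination over `c` with the same
coefficient on each common ray (independent corners). [cite: Fulton1993Toric, §2.6] -/
theorem HConeN.exists_transport {c c' : HConeN n} (hc : c.Indep) (hc' : c'.Indep) (lam' : Fin n → ℚ)
    (hsupp : ∀ k', lam' k' ≠ 0 → c'.ray k' ∈ Set.range c.ray) :
    ∃ nu : Fin n → ℚ, c.comb nu = c'.comb lam' ∧ (∀ k k', c.ray k = c'.ray k' → nu k = lam' k') ∧
      ∀ k, c.ray k ∉ Set.range c'.ray → nu k = 0 := by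
  refine ⟨fun k => ∑ k', if c'.ray k' = c.ray k then lam' k' else 0, ?_, ?_, ?_⟩
  · unfold HConeN.comb
    simp only [Finset.sum_smul, ite_smul, zero_smul]
    rw [Finset.sum_comm]
    refine Finset.sum_congr rfl (fun k' _ => ?_)
    by_cases h0 : lam' k' = 0
    · simp [h0]
    · obtain ⟨k, hk⟩ := hsupp k' h0
      rw [Finset.sum_eq_single k]
      · simp [hk, HConeN.rq_eq_vqN]
      · intro j _ hj
        have : c'.ray k' ≠ c.ray j := fun h => hj (hc.ray_injective (h.symm.trans hk.symm))
        simp [this]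
      · simp
  · intro k k' hkk'
    show (∑ k'', if c'.ray k'' = c.ray k then lam' k'' else 0) = lam' k'
    rw [Finset.sum_eq_single k']
    · simp [hkk']
    · intro j _ hj
      have : c'.ray j ≠ c.ray k := fun h => hj (hc'.ray_injective (h.trans hkk'))
      simp [this]
    · simp
  · intro k hk
    show (∑ k'', if c'.ray k'' = c.ray k then lam' k'' else 0) = 0
    refine Finset.sum_eq_zero (fun k' _ => ?_)
    have : c'.ray k' ≠ c.ray k := fun h => hk ⟨k', h⟩
    simp [this]

/-- Coefficient comparison on a common ray. [cite: Fulton1993Toric, §2.6] -/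
theorem HConeN.coeff_eq_of_common {c c' : HConeN n} (hc : c.Indep) (hc' : c'.Indep) {lam lam' : Fin n → ℚ}
    (hx : c.comb lam = c'.comb lam') (hsupp : ∀ k', lam' k' ≠ 0 → c'.ray k' ∈ Set.range c.ray)
    {k k' : Fin n} (hkk' : c.ray k = c'.ray k') : lam k = lam' k' := by
  obtain ⟨nu, hnu, hcoef, -⟩ := HConeN.exists_transport hc hc' lam' hsupp
  have : lam = nu := hc.comb_injective (hx.trans hnu.symm)
  rw [this]; exact hcoef k k' hkk'

/-- Support comparison: a coefficient can be non-zero only on a ray of the other corner. [cite: Fulton1993Toric, §2.6] -/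
theorem HConeN.coeff_eq_zero_of_not_mem {c c' : HConeN n} (hc : c.Indep) (hc' : c'.Indep) {lam lam' : Fin n → ℚ}
    (hx : c.comb lam = c'.comb lam') (hsupp : ∀ k', lam' k' ≠ 0 → c'.ray k' ∈ Set.range c.ray)
    {k : Fin n} (hk : c.ray k ∉ Set.range c'.ray) : lam k = 0 := by
  obtain ⟨nu, hnu, -, hzero⟩ := HConeN.exists_transport hc hc' lam' hsupp
  have : lam = nu := hc.comb_injective (hx.trans hnu.symm)
  rw [this]; exact hzero k hk

/-- **FRESHNESS OF THE NEW RAY.**  In an independent corner `c` whose face `R` has at least two rays, `ρ_R` is not a ray of any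
independent corner `D` in face position with `c` (the new ray of a star subdivision lies in the relative interior of the
subdivided face).  [cite: Fulton1993Toric, §2.6] -/
theorem rhoN_not_mem_range {c D : HConeN n} (hc : c.Indep) (hD : D.Indep) (hcD : c.FaceInter D) {R : Finset (Fin n → ℤ)}
    (hR : c.Contains R) (h2 : 2 ≤ R.card) : rhoN R ∉ Set.range D.ray := by
  rintro ⟨j, hj⟩
  have hind := HConeN.comb_indicator_slots hc hR
  have hin : D.InCone (c.comb fun k => if k ∈ c.slots R then 1 else 0) := by
    rw [hind]
    refine ⟨Pi.single j 1, fun k => by by_cases hk : k = j <;> simp [hk], ?_⟩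
    rw [HConeN.comb_single, HConeN.rq_eq_vqN, hj]
  have hRD : D.Contains R := by
    intro r hr
    obtain ⟨t, -, rfl⟩ := Finset.mem_image.mp (hR hr)
    have ht : t ∈ c.slots R := (HConeN.mem_slots c R t).mpr hr
    have := hcD _ (fun k => by by_cases hk : k ∈ c.slots R <;> simp [hk]) hin t (by simp [ht])
    obtain ⟨j', hj'⟩ := this
    exact Finset.mem_image.mpr ⟨j', Finset.mem_univ _, hj'⟩
  have hindD := HConeN.comb_indicator_slots hD hRD
  have hsingle : D.comb (Pi.single j 1) = vqN (rhoN R) := by rw [HConeN.comb_single, HConeN.rq_eq_vqN, hj]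
  have heq : (fun k => if k ∈ D.slots R then (1 : ℚ) else 0) = Pi.single j 1 :=
    hD.comb_injective (hindD.trans hsingle.symm)
  have hcard : (D.slots R).card = R.card := HConeN.card_slots hD hRD
  obtain ⟨t, ht, htj⟩ : ∃ t ∈ D.slots R, t ≠ j := by
    by_contra hno
    push Not at hno
    have hsub : D.slots R ⊆ {j} := fun t ht => Finset.mem_singleton.mpr (hno t ht)
    have := Finset.card_le_card hsub
    rw [Finset.card_singleton, hcard] at this
    omega
  have := congr_fun heq t
  simp [ht, htj] at this

end Slots

/-! ## §4 Preservation of the fan invariant under star subdivision -/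

section Blowup

/-- Members of the blow-up of one corner. [cite: Blanco2012a, Def. 1.22, Rem. 1.23] -/
theorem HConeN.mem_blowup {c d : HConeN n} {R : Finset (Fin n → ℤ)} :
    d ∈ c.blowup R ↔ (c.Contains R ∧ ∃ s ∈ c.slots R, c.child (c.slots R) s = d) ∨ (¬ c.Contains R ∧ c = d) := by
  unfold HConeN.blowup
  split_ifs with h
  · simp only [List.mem_map, Finset.mem_toList, h, true_and, not_true_eq_false, false_and, or_false]
  · simp [h, eq_comm]

/-- Members of the blown-up stage. [cite: Blanco2012a, Def. 1.22] -/
theorem HStageN.mem_blowup {S : HStageN n} {d : HConeN n} {R : Finset (Fin n → ℤ)} :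
    d ∈ S.blowup R ↔ ∃ c ∈ S, (c.Contains R ∧ ∃ s ∈ c.slots R, c.child (c.slots R) s = d) ∨ (¬ c.Contains R ∧ c = d) := by
  unfold HStageN.blowup
  simp only [List.mem_flatten, List.mem_map]
  constructor
  · rintro ⟨l, ⟨c, hc, rfl⟩, hd⟩; exact ⟨c, hc, HConeN.mem_blowup.mp hd⟩
  · rintro ⟨c, hc, h⟩; exact ⟨_, ⟨c, hc, rfl⟩, HConeN.mem_blowup.mpr h⟩

/-- If every slot of `R` in `c` points to a ray of `D`, then `D` contains `R`. [cite: Blanco2012a, Rem. 1.23] -/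
theorem HConeN.contains_of_forall_slots {c D : HConeN n} {R : Finset (Fin n → ℤ)} (hR : c.Contains R)
    (h : ∀ t ∈ c.slots R, c.ray t ∈ Set.range D.ray) : D.Contains R := by
  intro r hr
  obtain ⟨t, -, rfl⟩ := Finset.mem_image.mp (hR hr)
  obtain ⟨j, hj⟩ := h t ((HConeN.mem_slots c R t).mpr hr)
  exact Finset.mem_image.mpr ⟨j, Finset.mem_univ _, hj⟩

/-- Face intersection: child vs a corner NOT containing the face. [cite: Fulton1993Toric, §2.6] -/
theorem HConeN.FaceInter.child_left {c D : HConeN n} (hcD : c.FaceInter D) {R : Finset (Fin n → ℤ)} (hR : c.Contains R)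
    (hD : ¬ D.Contains R) {s : Fin n} (hs : s ∈ c.slots R) : (c.child (c.slots R) s).FaceInter D := by
  intro mu hmu hin k hk
  set T := c.slots R
  rw [HConeN.comb_child c T hs] at hin
  have hpull := hcD (pullN T s mu) (pullN_nonneg T hs hmu) hin
  by_cases hks : k = s
  · subst hks
    exfalso
    have hpos : 0 < mu k := lt_of_le_of_ne (hmu k) (Ne.symm hk)
    refine hD (HConeN.contains_of_forall_slots hR (fun t ht => hpull t ?_))
    exact ne_of_gt (lt_of_lt_of_le hpos (le_pullN_of_mem T hs hmu ht))
  · rw [HConeN.ray_child_of_ne c T hks]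
    have hpos : 0 < mu k := lt_of_le_of_ne (hmu k) (Ne.symm hk)
    exact hpull k (ne_of_gt (lt_of_lt_of_le hpos (le_pullN_of_ne T hs hmu hks)))

/-- Face intersection: a corner NOT containing the face vs a child. [cite: Fulton1993Toric, §2.6] -/
theorem HConeN.FaceInter.child_right {c D : HConeN n} (hc : c.Indep) (hDI : D.Indep) (hDc : D.FaceInter c)
    {R : Finset (Fin n → ℤ)} (hR : c.Contains R) (hD : ¬ D.Contains R) {s : Fin n} (hs : s ∈ c.slots R) :
    D.FaceInter (c.child (c.slots R) s) := by
  intro lam hlam hin k hk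
  set T := c.slots R
  have hinC : c.InCone (D.comb lam) := HConeN.inCone_of_inCone_child c T hs hin
  obtain ⟨j, hj⟩ := hDc lam hlam hinC k hk
  by_cases hjs : j = s
  · exfalso
    subst hjs
    obtain ⟨mu, hmu, hx⟩ := hin
    rw [HConeN.comb_child c T hs] at hx
    have hsupp : ∀ k', lam k' ≠ 0 → D.ray k' ∈ Set.range c.ray := fun k' hk' => hDc lam hlam hinC k' hk'
    have hco : pullN T j mu j = lam k := HConeN.coeff_eq_of_common hc hDI hx hsupp hj
    rw [pullN_self T hs] at hco
    have hpos : 0 < mu j := by rw [hco]; exact lt_of_le_of_ne (hlam k) (Ne.symm hk)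
    refine hD (HConeN.contains_of_forall_slots hR (fun t ht => ?_))
    by_contra hnot
    have h0 : pullN T j mu t = 0 := HConeN.coeff_eq_zero_of_not_mem hc hDI hx hsupp hnot
    have := le_pullN_of_mem T hs hmu ht
    linarith
  · exact ⟨j, by rw [HConeN.ray_child_of_ne c T hjs, hj]⟩

/-- Face intersection: child vs child (same or different parents containing the face). [cite: Fulton1993Toric, §2.6] -/
theorem HConeN.FaceInter.child_child {c c' : HConeN n} (hc : c.Indep) (hc' : c'.Indep) (hcc' : c.FaceInter c')
    (hc'c : c'.FaceInter c) {R : Finset (Fin n → ℤ)} (hR : c.Contains R) (hR' : c'.Contains R) {s s' : Fin n}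
    (hs : s ∈ c.slots R) (hs' : s' ∈ c'.slots R) : (c.child (c.slots R) s).FaceInter (c'.child (c'.slots R) s') := by
  intro mu hmu hin k hk
  set T := c.slots R
  set T' := c'.slots R
  have hpos : 0 < mu k := lt_of_le_of_ne (hmu k) (Ne.symm hk)
  by_cases hks : k = s
  · subst hks
    refine ⟨s', ?_⟩
    rw [HConeN.ray_child_slots_self hc' hR', HConeN.ray_child_slots_self hc hR]
  · rw [HConeN.ray_child_of_ne c T hks]
    have hinC' : c'.InCone ((c.child T s).comb mu) := HConeN.inCone_of_inCone_child c' T' hs' hin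
    rw [HConeN.comb_child c T hs] at hinC'
    obtain ⟨j, hj⟩ := hcc' (pullN T s mu) (pullN_nonneg T hs hmu) hinC' k
      (ne_of_gt (lt_of_lt_of_le hpos (le_pullN_of_ne T hs hmu hks)))
    by_cases hjs' : j = s'
    · exfalso
      subst hjs'
      have hkT : k ∈ T := (HConeN.mem_slots c R k).mpr (by rw [← hj]; exact (HConeN.mem_slots c' R j).mp hs')
      obtain ⟨mu', hmu', hx'⟩ := hin
      rw [HConeN.comb_child c T hs, HConeN.comb_child c' T' hs'] at hx'
      have hinC : c.InCone (c'.comb (pullN T' j mu')) := by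
        rw [hx']; exact c.inCone_comb (pullN_nonneg T hs hmu)
      have hsupp : ∀ k', pullN T' j mu' k' ≠ 0 → c'.ray k' ∈ Set.range c.ray :=
        fun k' hk' => hc'c _ (pullN_nonneg T' hs' hmu') hinC k' hk'
      have h1 : pullN T s mu k = pullN T' j mu' j := HConeN.coeff_eq_of_common hc hc' hx'.symm hsupp hj.symm
      rw [pullN_of_mem T hkT hks, pullN_self T' hs'] at h1
      have hsR : c.ray s ∈ R := (HConeN.mem_slots c R s).mp hs
      obtain ⟨j₀, -, hj₀⟩ := Finset.mem_image.mp (hR' hsR)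
      have hj₀T : j₀ ∈ T' := (HConeN.mem_slots c' R j₀).mpr (by rw [hj₀]; exact hsR)
      have hj₀j : j₀ ≠ j := by
        rintro rfl
        exact hks (hc.ray_injective (hj.symm.trans hj₀))
      have h2 : pullN T s mu s = pullN T' j mu' j₀ := HConeN.coeff_eq_of_common hc hc' hx'.symm hsupp hj₀.symm
      rw [pullN_self T hs, pullN_of_mem T' hj₀T hj₀j] at h2
      have := hmu' j₀
      linarith
    · exact ⟨j, by rw [HConeN.ray_child_of_ne c' T' hjs', hj]⟩

end Blowup

/-! ## §5 The blown-up stage is a fan; strictly reachable stages are fans; consequences -/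

section IsFanBlowup

variable {S : HStageN n} {R : Finset (Fin n → ℤ)}

/-- Members of the blown-up stage are independent. [cite: Fulton1993Toric, §2.6] -/
theorem HStageN.indep_of_mem_blowup (hI : ∀ c ∈ S, c.Indep) {d : HConeN n} (hd : d ∈ S.blowup R) : d.Indep := by
  obtain ⟨c, hc, h⟩ := HStageN.mem_blowup.mp hd
  rcases h with ⟨-, s, hs, rfl⟩ | ⟨-, rfl⟩
  · exact (hI c hc).child _ hs
  · exact hI c hc

/-- Members of the blown-up stage are pairwise in face position. [cite: Fulton1993Toric, §2.6] -/
theorem HStageN.faceInter_of_mem_blowup (hI : ∀ c ∈ S, c.Indep) (hF : ∀ c ∈ S, ∀ c' ∈ S, c.FaceInter c')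
    {d d' : HConeN n} (hd : d ∈ S.blowup R) (hd' : d' ∈ S.blowup R) : d.FaceInter d' := by
  obtain ⟨c, hc, h⟩ := HStageN.mem_blowup.mp hd
  obtain ⟨c', hc', h'⟩ := HStageN.mem_blowup.mp hd'
  rcases h with ⟨hR, s, hs, rfl⟩ | ⟨hR, rfl⟩ <;> rcases h' with ⟨hR', s', hs', rfl⟩ | ⟨hR', rfl⟩
  · exact HConeN.FaceInter.child_child (hI c hc) (hI c' hc') (hF c hc c' hc') (hF c' hc' c hc) hR hR' hs hs'
  · exact HConeN.FaceInter.child_left (hF c hc c' hc') hR hR' hs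
  · exact HConeN.FaceInter.child_right (hI c' hc') (hI c hc) (hF c hc c' hc') hR' hR hs'
  · exact hF c hc c' hc'

/-- `c` contains the singleton face `{r}` iff `r` is one of its rays. [cite: Blanco2012a, Rem. 1.23] -/
theorem HConeN.contains_singleton_iff (c : HConeN n) (r : Fin n → ℤ) : c.Contains {r} ↔ r ∈ Set.range c.ray := by
  constructor
  · intro h
    obtain ⟨t, -, ht⟩ := Finset.mem_image.mp (h (Finset.mem_singleton_self r))
    exact ⟨t, ht⟩
  · rintro ⟨t, rfl⟩ x hx
    rw [Finset.mem_singleton] at hx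
    subst hx
    exact Finset.mem_image.mpr ⟨t, Finset.mem_univ _, rfl⟩

/-- **Heights stay a function of the ray vector** after blowing up a non-empty face contained in some corner (freshness of
`ρ_R` for `|R| ≥ 2`; for `|R| = 1` every corner through the ray bumps its height by one).  [cite: Blanco2012a, Def. 1.22;
Fulton1993Toric, §2.6] -/
theorem HStageN.exists_heightFn_blowup (hI : ∀ c ∈ S, c.Indep) (hF : ∀ c ∈ S, ∀ c' ∈ S, c.FaceInter c')
    {H : (Fin n → ℤ) → ℤ} (hH : S.HeightFn H) (hne : R.Nonempty) (hex : ∃ c ∈ S, c.Contains R) :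
    ∃ H', (S.blowup R).HeightFn H' ∧ (∀ r, (∃ c ∈ S, r ∈ Set.range c.ray) → r ≠ rhoN R → H' r = H r) ∧
      H' (rhoN R) = 1 + ∑ r ∈ R, H r := by
  obtain ⟨c₀, hc₀, hR₀⟩ := hex
  by_cases h2 : 2 ≤ R.card
  · refine ⟨Function.update H (rhoN R) (1 + ∑ r ∈ R, H r), fun d hd k => ?_,
      fun r _ hr => Function.update_of_ne hr _ _, Function.update_self _ _ _⟩
    obtain ⟨c, hc, h⟩ := HStageN.mem_blowup.mp hd
    have hfresh : rhoN R ∉ Set.range c.ray := rhoN_not_mem_range (hI c₀ hc₀) (hI c hc) (hF c₀ hc₀ c hc) hR₀ h2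
    rcases h with ⟨hR, s, hs, rfl⟩ | ⟨-, rfl⟩
    · by_cases hks : k = s
      · subst hks
        rw [HConeN.ray_child_slots_self (hI c hc) hR, HConeN.height_child_slots_self (hI c hc) hR k (hH c hc),
          Function.update_self]
      · rw [HConeN.ray_child_of_ne c _ hks, HConeN.height_child_of_ne c _ hks, hH c hc k,
          Function.update_of_ne (fun h => hfresh ⟨k, h⟩)]
    · rw [hH c hc k, Function.update_of_ne (fun h => hfresh ⟨k, h⟩)]
  · have h1 : R.card = 1 := by have := hne.card_pos; omega
    obtain ⟨r, rfl⟩ := Finset.card_eq_one.mp h1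
    have hrho : rhoN ({r} : Finset (Fin n → ℤ)) = r := by simp [rhoN]
    refine ⟨Function.update H r (H r + 1), fun d hd k => ?_, fun r' _ hr' => ?_, ?_⟩
    · obtain ⟨c, hc, h⟩ := HStageN.mem_blowup.mp hd
      rcases h with ⟨hR, s, hs, rfl⟩ | ⟨hR, rfl⟩
      · have hrs : c.ray s = r := Finset.mem_singleton.mp ((HConeN.mem_slots c {r} s).mp hs)
        by_cases hks : k = s
        · subst hks
          rw [HConeN.ray_child_slots_self (hI c hc) hR, HConeN.height_child_slots_self (hI c hc) hR k (hH c hc)]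
          simp [rhoN, add_comm]
        · have hne' : c.ray k ≠ r := fun h => hks ((hI c hc).ray_injective (h.trans hrs.symm))
          rw [HConeN.ray_child_of_ne c _ hks, HConeN.height_child_of_ne c _ hks, hH c hc k, Function.update_of_ne hne']
      · have hne' : c.ray k ≠ r := fun h => hR ((HConeN.contains_singleton_iff c r).mpr ⟨k, h⟩)
        rw [hH c hc k, Function.update_of_ne hne']
    · rw [hrho] at hr'
      exact Function.update_of_ne hr' _ _
    · rw [hrho, Function.update_self, Finset.sum_singleton, add_comm]

/-- **THE BLOWN-UP STAGE IS A FAN** (non-empty face contained in some corner of a fan stage). [cite: Fulton1993Toric, §2.6] -/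
theorem HStageN.IsFan.blowup (hS : S.IsFan) (hne : R.Nonempty) (hex : ∃ c ∈ S, c.Contains R) : (S.blowup R).IsFan := by
  obtain ⟨hI, hF, H, hH⟩ := hS
  obtain ⟨H', hH', -, -⟩ := HStageN.exists_heightFn_blowup hI hF hH hne hex
  exact ⟨fun d hd => HStageN.indep_of_mem_blowup hI hd,
    fun d hd d' hd' => HStageN.faceInter_of_mem_blowup hI hF hd hd', H', hH'⟩

/-- The single corner of the initial stage. [cite: Blanco2012a, Rem. 1.2] -/
theorem mem_initialHStageN {c : HConeN n} :
    c ∈ initialHStageN n ↔ c = { ray := fun i j => if i = j then 1 else 0, height := fun _ => 0 } := by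
  simp [initialHStageN]

/-- **The initial stage is a fan.** [cite: Fulton1993Toric, §2.6] -/
theorem isFan_initialHStageN : (initialHStageN n).IsFan := by
  refine ⟨fun c hc => ?_, fun c hc c' hc' => ?_, ⟨fun _ => 0, fun c hc k => ?_⟩⟩
  · rw [mem_initialHStageN.mp hc]
    refine HConeN.indep_of_comb_eq_zero (fun mu hmu => ?_)
    funext k
    have := congr_fun hmu k
    rw [HConeN.comb_apply] at this
    simpa [Finset.sum_ite_eq', eq_comm] using this
  · rw [mem_initialHStageN.mp hc, mem_initialHStageN.mp hc']
    intro lam _ _ k _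
    exact ⟨k, rfl⟩
  · rw [mem_initialHStageN.mp hc]

/-- **Every strictly reachable stage is a fan.** [cite: Blanco2012a, Def. 1.16; Fulton1993Toric, §2.6] -/
theorem StrictReachableN.isFan {A : Finset (Fin n → ℚ)} {S : HStageN n} (h : StrictReachableN A S) : S.IsFan := by
  induction h with
  | init => exact isFan_initialHStageN
  | step R _ hl ih =>
    obtain ⟨hne, ⟨c, hc, hR⟩, -⟩ := hl
    exact ih.blowup hne ⟨c, hc, hR⟩

/-- LEGALITY IN HEIGHTS FORM at dimension `n`: `T` is permissible at the derived board of `(r, b)` iff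
`⟨v, Σ_T r⟩ ≥ 1 + Σ_T b` for every `v ∈ A`.  [cite: Blanco2012a, Def. 1.18 with Rem. 1.12–1.13] -/
theorem isPermissible_coordN_iff (A : Finset (Fin n → ℚ)) (r : Fin n → (Fin n → ℤ)) (b : Fin n → ℤ) (T : Finset (Fin n)) :
    IsPermissible (A.image (fun v => coordN v r b)) T ↔
      ∀ v ∈ A, (1 : ℚ) + ∑ t ∈ T, (b t : ℚ) ≤ ∑ i, v i * ((∑ t ∈ T, r t) i : ℚ) := by
  simp only [IsPermissible, Finset.mem_image, forall_exists_index, and_imp, forall_apply_eq_imp_iff₂, coordN,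
    Finset.sum_sub_distrib, Finset.sum_apply, Int.cast_sum, Finset.mul_sum]
  constructor
  · intro h v hv; have := h v hv; rw [Finset.sum_comm] at this; linarith
  · intro h v hv; have := h v hv; rw [Finset.sum_comm]; linarith

/-- **LEGALITY IS FACE-INTRINSIC ON A FAN STAGE**: two corners of a fan stage containing the face `R` agree on the permissibility
of its slots.  [cite: Blanco2012a, Def. 1.18, Rem. 1.13] -/
theorem HStageN.IsFan.isPermissible_iff (hS : S.IsFan) (A : Finset (Fin n → ℚ)) {c c' : HConeN n} (hc : c ∈ S) (hc' : c' ∈ S)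
    (hR : c.Contains R) (hR' : c'.Contains R) :
    IsPermissible (c.board A) (c.slots R) ↔ IsPermissible (c'.board A) (c'.slots R) := by
  obtain ⟨hI, -, H, hH⟩ := hS
  have key : ∀ d ∈ S, d.Contains R → (IsPermissible (d.board A) (d.slots R) ↔
      ∀ v ∈ A, (1 : ℚ) + ∑ r ∈ R, (H r : ℚ) ≤ ∑ i, v i * (rhoN R i : ℚ)) := by
    intro d hd hdR
    rw [HConeN.board, isPermissible_coordN_iff]
    have h1 : ∑ t ∈ d.slots R, (d.height t : ℚ) = ∑ r ∈ R, (H r : ℚ) := by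
      rw [← HConeN.sum_slots (hI d hd) hdR (fun r => (H r : ℚ))]
      exact Finset.sum_congr rfl (fun t _ => by rw [hH d hd t])
    have h2 : ∑ t ∈ d.slots R, d.ray t = rhoN R := by rw [rhoN]; exact HConeN.sum_slots (hI d hd) hdR id
    simp only [h1, h2]
  rw [key c hc hR, key c' hc' hR']

/-- **Heights child ↔ game move on the derived board** (dimension `n`): the derived board of the child corner `c.child T s` is
Hironaka's move `σ_{T,s}` applied to the derived board of `c`.  [cite: EncinasVillamayor1998, Def. 1.4] -/
theorem HConeN.board_child (A : Finset (Fin n → ℚ)) (c : HConeN n) (T : Finset (Fin n)) (s : Fin n) :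
    (c.child T s).board A = (c.board A).image (gameMove T s) := by
  unfold HConeN.board HConeN.child
  rw [Finset.image_image]
  refine Finset.image_congr (fun v _ => ?_)
  exact (gameMove_coordN v c.ray c.height T s).symm

/-- The derived board of the initial corner is the position itself. [cite: Blanco2012a, Rem. 1.2] -/
theorem board_initialConeN (A : Finset (Fin n → ℚ)) :
    ({ ray := fun i j => if i = j then 1 else 0, height := fun _ => 0 } : HConeN n).board A = A := by
  unfold HConeN.board
  have : (fun v : Fin n → ℚ => coordN v (fun i j => if i = j then (1 : ℤ) else 0) (fun _ => 0)) = id := by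
    funext v k
    simp [coordN]
  rw [this, Finset.image_id]

/-- **Boards stay positions** under a move that is permissible at every corner it subdivides. [cite: Spivakovsky1983, §I p. 420] -/
theorem HStageN.isPosition_of_mem_blowup {A : Finset (Fin n → ℚ)} (hpos : ∀ c ∈ S, IsPosition (c.board A))
    (hperm : ∀ c ∈ S, c.Contains R → IsPermissible (c.board A) (c.slots R)) {d : HConeN n} (hd : d ∈ S.blowup R) :
    IsPosition (d.board A) := by
  obtain ⟨c, hc, h⟩ := HStageN.mem_blowup.mp hd
  rcases h with ⟨hR, s, _, rfl⟩ | ⟨-, rfl⟩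
  · rw [HConeN.board_child]
    exact isPosition_image_gameMove (hpos c hc) (hperm c hc hR) s
  · exact hpos c hc

/-- **Along strictly reachable stages every derived board is a position.** [cite: Spivakovsky1983, §I p. 420] -/
theorem StrictReachableN.isPosition_board {A : Finset (Fin n → ℚ)} (hA : IsPosition A) {S : HStageN n}
    (h : StrictReachableN A S) : ∀ c ∈ S, IsPosition (c.board A) := by
  induction h with
  | init =>
    intro c hc
    rw [mem_initialHStageN.mp hc, board_initialConeN]
    exact hA
  | step R _ hl ih =>
    obtain ⟨-, -, hperm⟩ := hl
    exact fun d hd => HStageN.isPosition_of_mem_blowup ih hperm hd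

end IsFanBlowup

end Literature.Combinatorics.HironakaPolyhedraGame
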